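import Literature.NumberTheory.GaloisRepresentations.CoinducedModule
import Literature.NumberTheory.GaloisRepresentations.GaloisCohomology
import Literature.NumberTheory.EllipticCurves.SubgroupSelmer
import HarnessLib

/-!
# X11b, route R1 — the coinduced module `M_G^H(A)` of a discrete `G`-module: the unit `A → M_G^H(A)`
# and the shift `S_γ − 1` (toward atom (L10) `CoinvariantsTrivialAt` of the control theorem)

HONEST FRAMING (cell `b2b-bsdres`, run/shared/lean/b2b/bsd-rank1-residual/, verbatim in every
file): the goal of the cell is to DELETE the COMBINATION-SHAPED residual classes of the
Birch–Swinnerton-Dyer formula for ALL analytic-rank `≤ 1` elliptic curves over `ℚ` — "full BSD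
formula for every rank `≤ 1` curve in class `C`" assembled STRICTLY from published theorems — so
that the rank-`≤ 1` remainder becomes exactly the CONSTRUCTION-SHAPED classes, which are TYPED
(missing-input `Prop`s), NOT attempted. This is not "finishing BSD". Sub-cell
`b2b-bsdres-multr1-p1` (X11b, route R1 = Castella 2018 Thm. A re-proved along the author's
erratum); a RESEARCH ROUTE; no claim beyond the stated class; X11b stays CONSTRUCTION-SHAPED;
nothing here changes a label; no named fact is minted (definitions with bodies and theorems; no
`sorry`).

## What this file does

Route R1's control input (CTL) = Cas18 Thm. 2.3 is, after gens 9–15, the conjunction of two typed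
Poitou–Tate atoms (P6) `BaseSelmerCountAt` and **(L10) `CoinvariantsTrivialAt`** (JSW17 Lemma 3.3.3:
`H¹_{ac}(K, M)_Γ = 0`, i.e. `conj_γ − 1` is ONTO Castella's `Sel_𝔭(K_∞, E[p^∞])`) plus a local atom.
JSW prove Lemma 3.3.3 from the long exact sequence of `0 → W → M →(γ−1) M → 0` with `M =
T ⊗ Λ^∨(Ψ⁻¹)` the `Λ`-adic (coinduced) module and `H¹(K, M) = H¹(K_∞, W)` (Shapiro). This file
sets up that sequence for an ARBITRARY topological group `G`, normal subgroup `H`, `γ ∈ G` and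
discrete `G`-module `A` with open stabilisers, on the tree's Serre model `M_G^H(A) = {a : G → A
continuous | a(h x) = h • a(x)}` (`CoinducedModule`, `(g a)(x) = a(x g)`):

* `discreteRep hA : ContinuousRep G ℤ A` (the `DistribMulAction` with open stabilisers; its
  `TopRep` is DEFINITIONALLY the tree's `discreteTopRep G A`, so its `H¹` is `discreteH1 G A`),
  `subRep hA H` (restriction to `H`; `TopRep = discreteTopRep H A`, `H¹ = subgroupH1 H A`);
* `unitHom : A ⟶ M_G^H(A)`, `a ↦ (x ↦ x • a)` (JSW's `W ⊂ M`);
* `shiftFun γ`, `(S_γ a)(x) = γ⁻¹ • a(γ x)` and `tHom γ = S_γ − 1 : M_G^H(A) ⟶ M_G^H(A)`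
  (`G`-equivariant; JSW's multiplication by `γ − 1 = T`).

Exactness (`0 → A → M →(S_γ−1) M → 0` for `H = ker(κ : G ↠ ℤ_p)`, `κ(γ) = 1`, `A` `p`-primary)
is `CoinducedShiftExact.lean`; the Shapiro/descent theorems are `ProcyclicDescent.lean`.

References: [JetchevSkinnerWan2017] Lemma 3.3.3 (arXiv:1512.06894 pp. 11–12);
[SerreGaloisCohomology1997] I §2.1, I §2.5; [Castella2018] Thm. 2.3 (arXiv:1704.06608 p. 5).
-/

noncomputable section

open CategoryTheory Function
open Literature.NumberTheory.GaloisRepresentations Literature.NumberTheory.EllipticCurves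

universe u

namespace Summit.BirchSwinnertonDyer.Rank1Residual.X11b.ProcyclicDescent

/-! ## 1. A discrete `G`-module with open stabilisers as a `ContinuousRep` (definitionally the
tree's `discreteTopRep`) -/

section DiscreteRep

variable (G : Type u) [Group G] (A : Type u) [AddCommGroup A] [DistribMulAction G A]

/-- The `ℤ`-linear representation `g ↦ (a ↦ g • a)` underlying a `DistribMulAction` (the same term as
in the tree's `discreteContRep`). [folklore] -/
def smulRep : Representation ℤ G A where
  toFun g := (DistribSMul.toAddMonoidHom A g).toIntLinearMap
  map_one' := by ext a; simp
  map_mul' g h := by ext a; simp [mul_smul]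

/-- Unfolding `smulRep`. [folklore] -/
@[simp] theorem smulRep_apply_apply (g : G) (a : A) : smulRep G A g a = g • a := rfl

variable {G A} in
/-- `x • (n • a) = n • (x • a)` for `n : ℤ` (the action is by additive maps). [folklore] -/
theorem smul_zsmul_comm (x : G) (n : ℤ) (a : A) : x • (n • a) = n • (x • a) :=
  map_zsmul (DistribSMul.toAddMonoidHom A x) n a

variable {G A}
variable [TopologicalSpace G] [IsTopologicalGroup G] [TopologicalSpace A] [DiscreteTopology A]

/-- A `DistribMulAction` on a discrete group with OPEN STABILISERS is a continuous representation
(Serre I §2.1 "`G`-module discret"). [cite: SerreGaloisCohomology1997, I §2.1] -/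
def discreteRep (hA : ∀ a : A, IsOpen {g : G | g • a = a}) : ContinuousRep G ℤ A :=
  ContinuousRep.ofStabilizerMemNhdsOne (smulRep G A) fun a =>
    (hA a).mem_nhds (by simp)

/-- Unfolding `discreteRep`. [folklore] -/
@[simp] theorem discreteRep_apply_apply (hA : ∀ a : A, IsOpen {g : G | g • a = a}) (g : G) (a : A) :
    discreteRep hA g a = g • a := rfl

/-- The `TopRep` of `discreteRep hA` IS the tree's `discreteTopRep G A` (definitionally), so that
`continuousCohomology n (discreteRep hA).toTopRep` is `discreteH1 G A` for `n = 1`. [folklore] -/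
theorem toTopRep_discreteRep (hA : ∀ a : A, IsOpen {g : G | g • a = a}) :
    (discreteRep hA).toTopRep = discreteTopRep G A := rfl

omit [IsTopologicalGroup G] [TopologicalSpace A] [DiscreteTopology A] in
/-- Open stabilisers pass to a subgroup (subspace topology). [folklore] -/
theorem isOpen_stabilizer_subgroup (hA : ∀ a : A, IsOpen {g : G | g • a = a}) (H : Subgroup G)
    (a : A) : IsOpen {h : H | h • a = a} :=
  (hA a).preimage continuous_subtype_val

end DiscreteRep

/-! ## 2. The coinduced module `M_G^H(A)`, the maps `unit : A → M`, `S = shift γ`, and the short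
exact sequence `0 → A → M →(S−1) M → 0` -/

section Coinduced

variable {G : Type u} [Group G] [TopologicalSpace G] [IsTopologicalGroup G]
variable {A : Type u} [AddCommGroup A] [DistribMulAction G A] [TopologicalSpace A]
  [DiscreteTopology A]
variable (hA : ∀ a : A, IsOpen {g : G | g • a = a}) (H : Subgroup G)

/-- The restriction of the discrete `G`-module `A` to the subgroup `H`, as a continuous
representation of `H` whose `TopRep` is definitionally `discreteTopRep H A` (so that its `H¹` is the
tree's `subgroupH1 H A`). [folklore] -/
def subRep : ContinuousRep H ℤ A := discreteRep (isOpen_stabilizer_subgroup hA H)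

/-- Unfolding `subRep`. [folklore] -/
@[simp] theorem subRep_apply_apply (h : H) (a : A) : subRep hA H h a = (h : G) • a := rfl

/-- `(subRep hA H).toTopRep = discreteTopRep H A` (definitional). [folklore] -/
theorem toTopRep_subRep : (subRep hA H).toTopRep = discreteTopRep H A := rfl

/-- `M_G^H(A)` is discrete for compact `G` (instance form of the tree's `discreteTopology_coind`).
[folklore] -/
instance instDiscreteTopologyCoind [CompactSpace G] : DiscreteTopology (coindModule (subRep hA H)) :=
  discreteTopology_coind _

/-- Elements of `M_G^H(A)`: `a(h x) = h • a(x)`. [cite: SerreGaloisCohomology1997, I §2.5] -/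
theorem coind_apply_mul (a : coindModule (subRep hA H)) (h : H) (x : G) :
    (a : C(G, A)) (h * x) = (h : G) • (a : C(G, A)) x :=
  (mem_coind_iff (subRep hA H) _).1 a.2 h x

include hA in
/-- The orbit map `x ↦ x • a` is continuous (joint continuity of `discreteRep hA`). [folklore] -/
theorem continuous_smul_const (a : A) : Continuous fun x : G => x • a :=
  (discreteRep hA).continuous_apply_left a

include hA in
/-- The action map `(x, a) ↦ x • a` is jointly continuous. [folklore] -/
theorem continuous_smul' : Continuous fun q : G × A => q.1 • q.2 :=
  (discreteRep hA).continuous_smul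

/-- **The unit `A → M_G^H(A)`, `a ↦ (x ↦ x • a)`** (Serre I §2.5: for a `G`-module `A`,
`M_G^H(A) ≅` the module coinduced from the trivial `H`-module; this is the inclusion of the constants
`W ⊂ M` of JSW's `0 → W → M → M → 0`). [cite: SerreGaloisCohomology1997, I §2.5] -/
def unitFun (a : A) : coindModule (subRep hA H) :=
  ⟨⟨fun x => x • a, continuous_smul_const hA a⟩, fun h x => by
    simp [mul_smul]⟩

/-- Unfolding `unitFun`. [folklore] -/
@[simp] theorem unitFun_apply (a : A) (x : G) : ((unitFun hA H a : coindModule (subRep hA H)) :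
    C(G, A)) x = x • a := rfl

/-- The unit as a morphism of topological `G`-representations `A ⟶ M_G^H(A)` (equivariance:
`(g · unit a)(x) = (x g) • a = unit (g • a)(x)`). [cite: SerreGaloisCohomology1997, I §2.5] -/
def unitHom [CompactSpace G] : (discreteRep hA).toTopRep ⟶ (coindRep (subRep hA H)).toTopRep :=
  TopRep.ofHom ⟨⟨{ toFun := unitFun hA H
                   map_add' := fun a b => Subtype.ext (ContinuousMap.ext fun x => by simp)
                   map_smul' := fun n a => Subtype.ext (ContinuousMap.ext fun x => by
                     simp [smul_zsmul_comm]) },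
    continuous_of_discreteTopology⟩, fun g => by
      ext a x
      change (x : G) • (g • a) =
        ((coindRep (subRep hA H) g (unitFun hA H a) : coindModule (subRep hA H)) : C(G, A)) x
      rw [coindRep_apply_apply, unitFun_apply, mul_smul]⟩

/-- Unfolding `unitHom`. [folklore] -/
@[simp] theorem unitHom_apply [CompactSpace G] (a : A) :
    (unitHom hA H).hom a = unitFun hA H a := rfl

variable (γ : G)

/-- The shift `S_γ : a ↦ (x ↦ γ⁻¹ • a(γ x))` preserves `M_G^H(A)` (`H` normal).
[cite: SerreGaloisCohomology1997, I §2.5] -/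
def shiftFun [H.Normal] (a : coindModule (subRep hA H)) : coindModule (subRep hA H) :=
  ⟨⟨fun x => γ⁻¹ • (a : C(G, A)) (γ * x),
    (continuous_of_discreteTopology (f := fun b : A => γ⁻¹ • b)).comp
      ((a : C(G, A)).continuous.comp (continuous_const.mul continuous_id))⟩, fun h x => by
    have hmem : γ * (h : G) * γ⁻¹ ∈ H := Subgroup.Normal.conj_mem inferInstance (h : G) h.2 γ
    change γ⁻¹ • (a : C(G, A)) (γ * ((h : G) * x)) = (h : G) • (γ⁻¹ • (a : C(G, A)) (γ * x))
    have e : γ * ((h : G) * x) = ((⟨_, hmem⟩ : H) : G) * (γ * x) := by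
      change γ * ((h : G) * x) = γ * (h : G) * γ⁻¹ * (γ * x)
      group
    rw [e, coind_apply_mul, smul_smul, smul_smul]
    change (γ⁻¹ * (γ * (h : G) * γ⁻¹)) • _ = _
    congr 1
    group⟩

/-- Unfolding `shiftFun`. [folklore] -/
@[simp] theorem shiftFun_apply [H.Normal] (a : coindModule (subRep hA H)) (x : G) :
    ((shiftFun hA H γ a : coindModule (subRep hA H)) : C(G, A)) x =
      γ⁻¹ • (a : C(G, A)) (γ * x) := rfl

/-- **`S_γ − 1` as a `G`-endomorphism of `M_G^H(A)`** (`S_γ` commutes with the right-translation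
action `(g a)(x) = a(x g)`); JSW's multiplication by `γ − 1 = T` on `M`.
[cite: JetchevSkinnerWan2017, Lemma 3.3.3 (arXiv:1512.06894 p. 11) (shape)] -/
def tHom [CompactSpace G] [H.Normal] :
    (coindRep (subRep hA H)).toTopRep ⟶ (coindRep (subRep hA H)).toTopRep :=
  TopRep.ofHom ⟨⟨{ toFun := fun a => shiftFun hA H γ a - a
                   map_add' := fun a b => by
                     refine Subtype.ext (ContinuousMap.ext fun x => ?_)
                     simp only [Submodule.coe_sub, Submodule.coe_add, ContinuousMap.sub_apply,
                       ContinuousMap.add_apply, shiftFun_apply, smul_add]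
                     abel
                   map_smul' := fun n a => by
                     refine Subtype.ext (ContinuousMap.ext fun x => ?_)
                     simp only [Submodule.coe_sub, Submodule.coe_smul_of_tower,
                       ContinuousMap.sub_apply, ContinuousMap.smul_apply, shiftFun_apply, smul_sub,
                       RingHom.id_apply, smul_zsmul_comm] },
    continuous_of_discreteTopology⟩, fun g => by
      ext a x
      change ((shiftFun hA H γ (coindRep (subRep hA H) g a) - coindRep (subRep hA H) g a :
          coindModule (subRep hA H)) : C(G, A)) x =
        ((coindRep (subRep hA H) g (shiftFun hA H γ a - a) : coindModule (subRep hA H)) :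
          C(G, A)) x
      simp only [Submodule.coe_sub, ContinuousMap.sub_apply, shiftFun_apply, coindRep_apply_apply,
        map_sub, mul_assoc]⟩

/-- Unfolding `tHom`: `(t a)(x) = γ⁻¹ • a(γ x) − a(x)`. [folklore] -/
@[simp] theorem tHom_apply_apply [CompactSpace G] [H.Normal] (a : coindModule (subRep hA H))
    (x : G) :
    (((tHom hA H γ).hom a : coindModule (subRep hA H)) : C(G, A)) x =
      γ⁻¹ • (a : C(G, A)) (γ * x) - (a : C(G, A)) x := rfl

end Coinduced

end Summit.BirchSwinnertonDyer.Rank1Residual.X11b.ProcyclicDescent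

end
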